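import Mathlib.Analysis.SpecialFunctions.Trigonometric.Basic
import Mathlib.Analysis.SpecialFunctions.Sqrt
import Summits.NavierStokesRegularity.TurbBounds.SpectralForm
import HarnessLib

/-!
# The cited reduction PER HORIZONTAL PERIOD: the spectral constraint restricted to the wavenumber lattice of a periodic domain
(cell `pub-turb` / `turb-bounds`, v2 lane; the statement file the fixed-period Rayleigh–Bénard rows RB-N1 / N1b / N1c / N2 (Γ = 2) need —
HOME/pub-turb-cert/RB-LEAN-V2-DESIGN.md §1 'per-period reduction = sos/lead statement file'; companion of `TurbBounds/SpectralForm.lean`.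
Written by pub-turb-sos, planner-pub-turb-sos-g13-0.)

HONEST FRAMING: rigorous bounds for the stated PDE and boundary conditions; no claim about physical turbulence beyond the bound.

PURPOSE. `SpectralForm.SpectralReduction Nu` transcribes the affine background-method reduction with the spectral constraint (A1) required for
EVERY horizontal wavenumber `k > 0`; that is the form the period-uniform rows (P2 ladder, RB-N0, RB-N1′, RB-N2′) consume. The cited theorem itself
is stated for a FIXED horizontally periodic box — [cite: DingKerswell2019, §2.1]: `(x, z) ∈ [−L/2, L/2] × [0, 1]`, periodic in `x`; §2.2 (13)–(16):
'if 𝒢 ≥ 0 for all (u, θ) ∈ Π (the set of incompressible velocity and temperature fields which satisfy homogeneous versions of the boundary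
conditions) … we then have the bound'; §5.1: 'setting a domain periodicity and insisting the fluctuation wavenumbers be consistent with this' versus
'the wavenumbers themselves can be optimised over as real continuous variables meaning, in effect, that L is infinite' — so after the horizontal
Fourier expansion (P2-PROOF 2.2 = FORMULATION-SPEC (B2)) the constraint of the `Γ`-periodic problem involves exactly the modes whose wavenumber
magnitude lies in the LATTICE of the domain (`2πm/Γ`, `m ≥ 1`, in `d = 2`; `2π√((m/Γx)² + (n/Γy)²)`, `(m, n) ≠ 0`, in `d = 3`; `k = 0` carries no
constraint). This file types that per-period form, parametrised by an arbitrary wavenumber set `L ⊆ ℝ`: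
* `SpectralConstraintOn L Ra s τ′` — (A1) in mode form for the wavenumbers `k ∈ L`, `k > 0`, on the two-sided class of `SpectralForm`;
* `SpectralReductionOn L Nu` — the NAMED HYPOTHESIS (harness model: a published theorem USED, never proved here) for solutions all of whose
  horizontal wavenumbers lie in `L`;
* `periodLattice2 Γ`, `periodLattice3 Γx Γy` — the wavenumber lattices of the periodic domains, with membership / positivity / inclusion lemmas;
* links: `spectralConstraintOn_of_spectralConstraint`, `spectralConstraintOn_mono`, `spectralConstraintOn_Ioi_iff` (the all-`k` constraint is the
  case `L = (0, ∞)`), `spectralReduction_of_spectralReductionOn` (the per-period hypothesis for the period of the solution at hand implies the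
  all-`k` hypothesis for it), `spectralReductionOn_mono` (a wavenumber set contained in a certified one is covered), `spectralReductionOn_Ioi_iff`;
* the certificate interface of a lattice row: `spectralConstraintOn_periodLattice2_of_cutoff` — finitely many lattice modes `m < M` certified
  one by one + a wavenumber cutoff valid for `k² ≥ K_c` + `K_c ≤ (2πM/Γ)²` ⇒ the lattice constraint; `sq_lattice_ge_of_pi_lower` discharges the
  last premise from any rational lower bound of `π` (rbsdp SPEC 1.3 / 3.2: `PI_LO = 4272943/1360120`, `K2_m = 4·PI_LO²m²/Γ² ≤ k_m²`);
* guards: `periodLattice2_nonempty` (the hypothesis' premise quantifies over a nonempty set), `spectralReductionOn_conduction` (satisfiable as typed).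
Real analysis over Mathlib only; NO Navier–Stokes / Boussinesq theory is formalised here. Nothing of this cell's own making is inside the named
hypothesis; everything else in the file is proved.
-/

set_option linter.style.longLine false

noncomputable section

namespace Summit.NavierStokesRegularity.TurbBounds.SpectralForm

open MeasureTheory intervalIntegral Set Real

/-! ## 1. The spectral constraint and the cited reduction restricted to a wavenumber set -/

/-- Statement (A1) of P2-PROOF 2.1 in mode form, RESTRICTED to the horizontal wavenumbers of the set `L`: `Q_k[w, θ] ≥ 0` for every
`k ∈ L` with `k > 0` and every two-sided pair `(w, θ)` (`SpectralForm.TwoSided`, `SpectralForm.modeForm`). For `L = (0, ∞)` this is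
`SpectralForm.SpectralConstraint` (`spectralConstraintOn_Ioi_iff`). -/
def SpectralConstraintOn (L : Set ℝ) (Ra s : ℝ) (τp : ℝ → ℝ) : Prop :=
  ∀ k ∈ L, 0 < k → ∀ w θ : ℝ → ℝ, TwoSided w θ → 0 ≤ modeForm Ra s τp k w θ

/-- **Named hypothesis `SpectralReductionOn L Nu`** (harness model; the PER-PERIOD form of `SpectralForm.SpectralReduction`). TRANSCRIPTION,
for the referee's line-by-line check: for every Rayleigh number `Ra > 0`, every balance parameter `s > 1` and every admissible profile
derivative `τ′` (`Profile τ′`), IF the spectral constraint (A1) holds in mode form for the wavenumbers of `L` — `SpectralConstraintOn L Ra s τ′`: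
`Q_k[w, θ] ≥ 0` for all `k ∈ L`, `k > 0`, and all two-sided `(w, θ)` — THEN `Nu(Ra) ≤ s ∫₀¹ τ′² − (s − 1)` (P2-PROOF (A2)).
CONTENT = the published affine background-method reduction '(A1) ⇒ (A2)' FOR A HORIZONTALLY PERIODIC BOX [cite: DingKerswell2019, §2.1–§2.2
(13)–(16)] (box `[−L/2, L/2] × [0, 1]`, periodic in `x`; 'if 𝒢 ≥ 0 for all (u, θ) ∈ Π … we then have the bound'; no-slip instance and variational
principle [cite: DoeringConstantin1996, Sec. III], [cite: DoeringGibbon1995, §10.3 (10.3.26)–(10.3.33)]) together with the classical horizontal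
Fourier / poloidal–toroidal decomposition of the admissible class `Π` of that box, which turns (A1) into the mode forms `Q_k` for exactly the
nonzero wavenumbers `k` of the box's lattice (P2-PROOF 2.2 = FORMULATION-SPEC (B2); [cite: DingKerswell2019, §5.1]: 'setting a domain periodicity
and insisting the fluctuation wavenumbers be consistent with this'; the `k = 0` mode carries no constraint, the toroidal part is a non-negative
extra term; refereed transcription checks R-A, R-B PASS, HOME/tribunal/t-lemmas.md pass 1), and the density remark of `TwoSided`'s docstring.
'Transcribed', not 'verbatim' (lead decision 100 (C)), exactly as for `SpectralReduction`.
MEANING OF `Nu` here: any function `Nu : ℝ → ℝ` such that `Nu Ra` is the Nusselt number `1 + ⟨wT⟩` of some admissible (Leray–Hopf,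
Galerkin-limit) solution of the Boussinesq system between no-slip isothermal plates at Rayleigh number `Ra`, arbitrary Prandtl number
`Pr ∈ (0, ∞]`, in a horizontally periodic domain (`d = 2`: period `Γ`; `d = 3`: periods `Γx, Γy`) EVERY nonzero horizontal wavenumber magnitude
of which lies in `L` — i.e. `periodLattice2 Γ ⊆ L`, resp. `periodLattice3 Γx Γy ⊆ L` (P2-PROOF §1). With `L = (0, ∞)` every period qualifies and
the hypothesis is `SpectralReduction Nu` (`spectralReductionOn_Ioi_iff`); for the period of a given solution the per-period hypothesis implies
the all-`k` one (`spectralReduction_of_spectralReductionOn`), and a smaller wavenumber set is covered by a larger certified one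
(`spectralReductionOn_mono`). A row theorem `∀ Nu, SpectralReductionOn (periodLattice2 Γ) Nu → Nu Ra ≤ B` is the bound for all `Γ`-periodic
solutions in `d = 2` and for all `d = 3` solutions whose wavenumber lattice lies in `periodLattice2 Γ`.
VACUITY: satisfiable as typed (`spectralReductionOn_conduction`); its premise quantifies over a nonempty wavenumber set for every lattice
(`periodLattice2_nonempty`). -/
def SpectralReductionOn (L : Set ℝ) (Nu : ℝ → ℝ) : Prop :=
  ∀ (Ra s : ℝ) (τp : ℝ → ℝ), 0 < Ra → 1 < s → Profile τp → SpectralConstraintOn L Ra s τp →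
    Nu Ra ≤ s * (∫ z in (0 : ℝ)..1, τp z ^ 2) - (s - 1)

/-! ## 2. The wavenumber lattices of the periodic domains -/

/-- The nonzero horizontal wavenumber magnitudes of a `d = 2` layer with horizontal period `Γ`: `k_m = 2πm/Γ`, `m = 1, 2, …`
(rbsdp SPEC 3.1 'Fixed period Γ: k_m = 2πm/Γ, m ≥ 1'). -/
def periodLattice2 (Γ : ℝ) : Set ℝ :=
  {k | ∃ m : ℕ, 1 ≤ m ∧ k = 2 * π * m / Γ}

/-- The nonzero horizontal wavenumber magnitudes of a `d = 3` layer with horizontal periods `Γx`, `Γy`: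
`|k| = 2π √((m/Γx)² + (n/Γy)²)`, `(m, n) ∈ ℤ² ∖ {0}`. -/
def periodLattice3 (Γx Γy : ℝ) : Set ℝ :=
  {k | ∃ m n : ℤ, (m ≠ 0 ∨ n ≠ 0) ∧ k = 2 * π * Real.sqrt ((m / Γx) ^ 2 + (n / Γy) ^ 2)}

/-- The `m`-th lattice wavenumber `2πm/Γ` (`m ≥ 1`) belongs to `periodLattice2 Γ`. -/
theorem mem_periodLattice2 (Γ : ℝ) {m : ℕ} (hm : 1 ≤ m) : 2 * π * m / Γ ∈ periodLattice2 Γ :=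
  ⟨m, hm, rfl⟩

/-- The `d = 2` lattice is nonempty (it contains `2π/Γ`), so `SpectralConstraintOn (periodLattice2 Γ)` is not a vacuous premise. -/
theorem periodLattice2_nonempty (Γ : ℝ) : (periodLattice2 Γ).Nonempty :=
  ⟨2 * π * (1 : ℕ) / Γ, mem_periodLattice2 Γ le_rfl⟩

/-- Every wavenumber of the `d = 2` lattice of a period `Γ > 0` is positive. -/
theorem periodLattice2_pos {Γ : ℝ} (hΓ : 0 < Γ) {k : ℝ} (hk : k ∈ periodLattice2 Γ) : 0 < k := by
  obtain ⟨m, hm, rfl⟩ := hk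
  have hm' : (0 : ℝ) < m := by exact_mod_cast hm
  positivity

/-- The `d = 2` lattice of period `Γx > 0` is contained in the `d = 3` lattice of periods `(Γx, Γy)` (the modes `(m, 0)`): a `d = 3`
certificate covers the `d = 2` problem of the same period, and conversely a row certified on `periodLattice2 Γ` covers exactly those `d = 3`
lattices contained in it (`spectralReductionOn_mono`). -/
theorem periodLattice2_subset_periodLattice3 {Γx : ℝ} (hΓx : 0 < Γx) (Γy : ℝ) :
    periodLattice2 Γx ⊆ periodLattice3 Γx Γy := by
  rintro k ⟨m, hm, rfl⟩
  have hm0 : (m : ℤ) ≠ 0 := by exact_mod_cast (by omega : m ≠ 0)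
  refine ⟨m, 0, Or.inl hm0, ?_⟩
  have hmx : 0 ≤ (m : ℝ) / Γx := by positivity
  have hsq : Real.sqrt ((((m : ℤ) : ℝ) / Γx) ^ 2 + (((0 : ℤ) : ℝ) / Γy) ^ 2) = (m : ℝ) / Γx := by
    rw [Int.cast_natCast, Int.cast_zero, zero_div, zero_pow two_ne_zero, add_zero, Real.sqrt_sq hmx]
  rw [hsq]
  ring

/-! ## 3. Links between the restricted and the all-`k` statements -/

/-- The all-`k` constraint implies the constraint on any wavenumber set. -/
theorem spectralConstraintOn_of_spectralConstraint {L : Set ℝ} {Ra s : ℝ} {τp : ℝ → ℝ} (h : SpectralConstraint Ra s τp) :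
    SpectralConstraintOn L Ra s τp :=
  fun k _ hk w θ hwθ => h k hk w θ hwθ

/-- The restricted constraint is antitone in the wavenumber set: a subset of a certified set is certified. -/
theorem spectralConstraintOn_mono {L L' : Set ℝ} (hLL' : L ⊆ L') {Ra s : ℝ} {τp : ℝ → ℝ} (h : SpectralConstraintOn L' Ra s τp) :
    SpectralConstraintOn L Ra s τp :=
  fun k hk hk0 w θ hwθ => h k (hLL' hk) hk0 w θ hwθ

/-- The constraint on `L = (0, ∞)` IS the all-`k` constraint `SpectralForm.SpectralConstraint`. -/
theorem spectralConstraintOn_Ioi_iff {Ra s : ℝ} {τp : ℝ → ℝ} :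
    SpectralConstraintOn (Ioi 0) Ra s τp ↔ SpectralConstraint Ra s τp :=
  ⟨fun h k hk w θ hwθ => h k hk hk w θ hwθ, fun h => spectralConstraintOn_of_spectralConstraint h⟩

/-- **Per-period ⇒ all-`k`.** If `Nu` obeys the cited reduction for SOME wavenumber set `L` (the lattice of the solution's own period), it obeys
`SpectralForm.SpectralReduction`: the all-`k` premise implies the `L`-premise. (So every period-uniform row theorem stated from
`SpectralReduction Nu` applies verbatim to a `Γ`-periodic solution described by `SpectralReductionOn (periodLattice2 Γ) Nu`.) -/
theorem spectralReduction_of_spectralReductionOn {L : Set ℝ} {Nu : ℝ → ℝ} (h : SpectralReductionOn L Nu) : SpectralReduction Nu :=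
  fun Ra s τp hRa hs hP hA => h Ra s τp hRa hs hP (spectralConstraintOn_of_spectralConstraint hA)

/-- **Monotonicity in the wavenumber set.** If `L ⊆ L'` then the hypothesis for `L` implies the hypothesis for `L'` (a certificate of the
constraint on the larger set `L'` serves every solution whose wavenumbers lie in the smaller set `L`). -/
theorem spectralReductionOn_mono {L L' : Set ℝ} (hLL' : L ⊆ L') {Nu : ℝ → ℝ} (h : SpectralReductionOn L Nu) :
    SpectralReductionOn L' Nu :=
  fun Ra s τp hRa hs hP hA => h Ra s τp hRa hs hP (spectralConstraintOn_mono hLL' hA)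

/-- The hypothesis for `L = (0, ∞)` IS `SpectralForm.SpectralReduction`. -/
theorem spectralReductionOn_Ioi_iff {Nu : ℝ → ℝ} : SpectralReductionOn (Ioi 0) Nu ↔ SpectralReduction Nu := by
  constructor
  · exact spectralReduction_of_spectralReductionOn
  · intro h Ra s τp hRa hs hP hA
    exact h Ra s τp hRa hs hP (spectralConstraintOn_Ioi_iff.mp hA)

/-- **Vacuity guard: `SpectralReductionOn L` is satisfiable as typed**, for every wavenumber set `L`: the conduction value `Nu ≡ 1` obeys it,
because every instance of the bound is `≥ 1` (`SpectralForm.sq_integral_ge_one`). -/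
theorem spectralReductionOn_conduction (L : Set ℝ) : SpectralReductionOn L (fun _ => 1) := by
  intro Ra s τp _ hs hprof _
  have h1 : 1 ≤ ∫ z in (0 : ℝ)..1, τp z ^ 2 := sq_integral_ge_one hprof
  have hs0 : 0 ≤ s := by linarith
  nlinarith [mul_le_mul_of_nonneg_left h1 hs0]

/-! ## 4. Certificate interface of a fixed-period (lattice) row -/

/-- The lattice wavenumbers grow with the index: `(2πM/Γ)² ≤ (2πm/Γ)²` for `M ≤ m` (`Γ > 0`). -/
theorem sq_lattice_mono {Γ : ℝ} (hΓ : 0 < Γ) {M m : ℕ} (hMm : M ≤ m) :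
    (2 * π * M / Γ) ^ 2 ≤ (2 * π * m / Γ) ^ 2 := by
  have hMm' : (M : ℝ) ≤ m := by exact_mod_cast hMm
  have h0 : 0 ≤ 2 * π * M / Γ := by positivity
  apply pow_le_pow_left₀ h0
  apply div_le_div_of_nonneg_right _ hΓ.le
  nlinarith [Real.pi_pos]

/-- Discharging the cutoff index from a RATIONAL lower bound of `π` (rbsdp SPEC 3.2: `K2_M = 4·PI_LO²·M²/Γ² ≤ k_M²`): if `0 ≤ p ≤ π` and
`K_c ≤ (2pM/Γ)²` then `K_c ≤ (2πM/Γ)²`. (The consumer supplies `p = PI_LO` with its own proof of `PI_LO ≤ π`; no numerics here.) -/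
theorem sq_lattice_ge_of_pi_lower {Γ Kc p : ℝ} (hΓ : 0 < Γ) (hp : 0 ≤ p) (hpπ : p ≤ π) (M : ℕ)
    (h : Kc ≤ (2 * p * M / Γ) ^ 2) : Kc ≤ (2 * π * M / Γ) ^ 2 := by
  have h0 : 0 ≤ 2 * p * M / Γ := by positivity
  have hle : 2 * p * M / Γ ≤ 2 * π * M / Γ := by
    apply div_le_div_of_nonneg_right _ hΓ.le
    have hM : (0 : ℝ) ≤ M := Nat.cast_nonneg M
    nlinarith
  exact h.trans (pow_le_pow_left₀ h0 hle 2)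

/-- **The lattice constraint from a finite certificate + cutoff** (the shape of every fixed-`Γ` row, rbsdp SPEC 3.8–3.9 / FORMAT-rbcert0 §2:
modes `m = 1 … M − 1` certified block by block, every wavenumber with `k² ≥ K_c` free by the cutoff lemma D1, and `K_c ≤ (2πM/Γ)²`):
then (A1) holds for every wavenumber of `periodLattice2 Γ`. -/
theorem spectralConstraintOn_periodLattice2_of_cutoff {Γ Ra s Kc : ℝ} {τp : ℝ → ℝ} (hΓ : 0 < Γ) (M : ℕ)
    (hM : Kc ≤ (2 * π * M / Γ) ^ 2)
    (hcut : ∀ k : ℝ, 0 < k → Kc ≤ k ^ 2 → ∀ w θ : ℝ → ℝ, TwoSided w θ → 0 ≤ modeForm Ra s τp k w θ)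
    (hfin : ∀ m : ℕ, 1 ≤ m → m < M → ∀ w θ : ℝ → ℝ, TwoSided w θ → 0 ≤ modeForm Ra s τp (2 * π * m / Γ) w θ) :
    SpectralConstraintOn (periodLattice2 Γ) Ra s τp := by
  rintro k ⟨m, hm, rfl⟩ hk w θ hwθ
  by_cases hmM : m < M
  · exact hfin m hm hmM w θ hwθ
  · exact hcut _ hk (hM.trans (sq_lattice_mono hΓ (not_lt.mp hmM))) w θ hwθ

/-- The same interface when the whole lattice is free (`M = 1`: the cutoff already covers `k² ≥ K_c` with `K_c ≤ (2π/Γ)²`; e.g. small `Ra`). -/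
theorem spectralConstraintOn_periodLattice2_of_cutoff_all {Γ Ra s Kc : ℝ} {τp : ℝ → ℝ} (hΓ : 0 < Γ)
    (h1 : Kc ≤ (2 * π / Γ) ^ 2)
    (hcut : ∀ k : ℝ, 0 < k → Kc ≤ k ^ 2 → ∀ w θ : ℝ → ℝ, TwoSided w θ → 0 ≤ modeForm Ra s τp k w θ) :
    SpectralConstraintOn (periodLattice2 Γ) Ra s τp :=
  spectralConstraintOn_periodLattice2_of_cutoff hΓ 1 (by simpa using h1) hcut (fun m hm hm1 => by omega)

end Summit.NavierStokesRegularity.TurbBounds.SpectralForm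

end
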